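import Literature.NumberTheory.EllipticCurves.Kobayashi2003.SignedSelmerRankBoundProofs
import Literature.NumberTheory.EllipticCurves.KatoRankBoundSelmerProofs
import HarnessLib

/-!
# `corank_{ℤ_p} Sel_{p^∞}(E/K) ≤ rank_{ℤ_p} X^ε(E/K_∞)/T X^ε(E/K_∞)` and `T^{corank} ∣ ξ^ε` for
# Kobayashi's signed Selmer groups (proofs; no named fact)

Topic `Literature/NumberTheory/EllipticCurves`, cluster `Kobayashi2003`; sibling PROOF file of
`SignedSelmer.lean` (Kobayashi's Def. 1.1, the Pontryagin-dual hypothesis structure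
`SignedSelmerDualData W κ γ ε`), of `SignedSelmerRankBoundProofs.lean` (`rank E(K) ≤ rank_{ℤ_p} X^ε/TX^ε`,
through the Kummer map of `E(K)`) and of the tree's `KatoRankBoundSelmerProofs.lean` (the CLASSICAL
`WeierstrassCurve.selmerCorank_le_coinvariantsRank`, Greenberg's "`corank_{ℤ_p} Sel_E(K)_p ≤ rank_{ℤ_p} X/TX`"
from his Lemma 3.1 alone). Everything here is PROVED; no definition and no named fact is introduced.
HONEST FRAMING: nothing about any curve is asserted; this is the SELMER-CORANK form of the "easy half of
control" for the signed Selmer groups, needed wherever a parity statement (which speaks of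
`corank Sel_{p^∞}(E/ℚ)`, not of `rank E(ℚ)`) is to be fed into a signed characteristic ideal.

## What is proved, and why

For EVERY number field `K`, EVERY `ℤ_p`-extension `κ = K_∞/K` with topological generator `γ`, EVERY sign
`ε` and EVERY datum `D : SignedSelmerDualData W κ γ ε` with `X^ε = D.X` finitely generated over
`Λ = ℤ_p⟦T⟧`:

* §1 `resInfty_mem_signedSelmerInfty` — the restriction `Sel_{p^∞}(E/K) → H¹(K_∞, E[p^∞])` LANDS IN
  `Sel^ε(E/K_∞)`: its image in `H¹(K_0, E[p^∞])` lies in `Sel(E/K_0) = Sel^ε(E/K_0)`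
  (`signedSelmerLayer_zero_eq`: Kobayashi's trace conditions are empty at `n = 0`,
  `E^±(F_{0,p}) = E(ℚ_p)`), whose image in `H¹(K_∞, ·)` is in `Sel^ε(E/K_∞) = ⋃_n im Sel^ε(E/K_n)` by
  definition (the argument of `resInfty_kummerMapPInfty_mem_signedSelmerInfty`, which needs only the
  Selmer condition of the class, not that it is a Kummer class).
* §2 `SignedSelmerDualData.selmerCorank_le_coinvariantsRank` —
  **`corank_{ℤ_p} Sel_{p^∞}(E/K) ≤ rank_{ℤ_p} X^ε/TX^ε`**: the proof of the classical
  `WeierstrassCurve.selmerCorank_le_coinvariantsRank` VERBATIM on the signed datum — Greenberg's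
  Lemma 3.1 (`θ^ε : Sel_{p^∞}(E/K) → Sel^ε(E/K_∞)` has finite kernel, as it embeds in
  `ker(H¹(K, E[p^∞]) → H¹(K_∞, E[p^∞]))`, tree `finite_subgroupResKer_kerSubgroup`), restriction of
  characters `X^ε → Hom(θ^ε(Sel), ℚ/ℤ)` killing `TX^ε` (restricted classes are `conj_γ`-invariant),
  and the corank count `ZpCorank.zpCorank_le_finrank_of_addEquiv_characterModule`.
* §3 `SignedSelmerDualData.selmerCorank_le_order_of_mem_charIdeal`,
  `….X_pow_selmerCorank_dvd_of_mem_charIdeal`, `….X_pow_selmerCorank_dvd_of_charIdeal_eq_span` —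
  **`corank Sel_{p^∞}(E/K) ≤ ord_{T=0} f` and `T^{corank} ∣ f` for every `f ∈ Char(X^ε)`**, `X^ε`
  finitely generated `Λ`-torsion (structure theory, `IwasawaAlgebra.coinvariantsRank_le_order_of_mem_charIdeal`).

No reduction hypothesis at `p`, no `a_p = 0`, no control theorem at `p` and no finiteness of `Ш` is
used (torsion-ness / finite generation of `X^ε` are displayed hypotheses; for `K = ℚ`, odd good
supersingular `p` with `a_p = 0` they are Kobayashi's Thm. 1.2, the named fact
`thm12_signedSelmerDual_finite_torsion` of `SignedSelmerTorsion.lean`).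

References: S. Kobayashi, Invent. Math. 152 (2003), Def. 1.1 (p. 2), Thm. 1.2 [Kobayashi2003];
R. Greenberg, *Iwasawa theory for elliptic curves*, LNM 1716 (1999), §1 p. 65 and §3 Lemma 3.1 (p. 86)
[GreenbergLNM1716]; B. Mazur, Invent. Math. 18 (1972), §6.
-/

noncomputable section

open CategoryTheory Literature.NumberTheory.EllipticCurves Literature.NumberTheory.GaloisRepresentations
  Literature.NumberTheory.EllipticCurves.ResKernel Literature.NumberTheory.EllipticCurves.IwasawaAlgebra
  Literature.NumberTheory.EllipticCurves.ZpCorank WeierstrassCurve ZpExtension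

open scoped Classical AddSubgroup

universe u

namespace Literature.NumberTheory.EllipticCurves.Kobayashi2003

/-! ## §1. `res_{K_∞/K}(Sel_{p^∞}(E/K)) ⊆ Sel^ε(E/K_∞)` -/

section Res

variable {K : Type u} [Field K] [NumberField K] (W : WeierstrassCurve K) {p : ℕ} [Fact p.Prime]
  (κ : ZpExtension K p) (ε : ℤˣ)

/-- **The restriction of a Selmer class to `K_∞` lies in `Sel^ε(E/K_∞)`** (both signs): for
`c ∈ Sel_{p^∞}(E/K)`, `res_{K_∞/K} c = res_{K_∞/K_0}(res_{K_0/K} c)` (`resOfLe_comp`) with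
`res_{K_0/K} c ∈ Sel(E/K_0) = Sel^ε(E/K_0)` (`signedSelmerLayer_zero_eq`: Kobayashi's Def. 1.1 at
`n = 0`, "`E^±(F_{0,p}) = E(ℚ_p)`"), and `Sel^ε(E/K_∞) = ⋃_n im Sel^ε(E/K_n)` by definition.
[cite: Kobayashi2003, Def. 1.1 (p. 2)] [cite: GreenbergLNM1716, §3 Lemma 3.1] -/
theorem resInfty_mem_signedSelmerInfty {c : galH1Primary W p} (hc : c ∈ W.selmerGroupPInfty p) :
    W.resInfty p κ c ∈ signedSelmerInfty W κ ε := by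
  have htop := W.resSubgroup_top_mem_selmerGroupOver hc
  have h0 : W.resOfLe p (le_top : κ.layerSubgroup 0 ≤ ⊤) (resSubgroup ⊤ (geomPrimaryTorsion W p) c) ∈
      W.selmerLayer κ 0 :=
    W.resOfLe_mem_selmerGroupOver p le_top htop
  have h0' := selmerLayer_zero_le_signedSelmerLayer W κ ε h0
  have heq : W.resInfty p κ c = W.layerToInfty κ 0
      (W.resOfLe p (le_top : κ.layerSubgroup 0 ≤ ⊤) (resSubgroup ⊤ (geomPrimaryTorsion W p) c)) := by
    rw [resInfty_eq_comp, AddMonoidHom.comp_apply, layerToInfty, ← AddMonoidHom.comp_apply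
      (W.resOfLe p (κ.kerSubgroup_le_layerSubgroup 0)), W.resOfLe_comp_holds p]
  rw [heq]
  exact map_layerToInfty_signedSelmerLayer_le W κ ε 0 ⟨_, h0', rfl⟩

end Res

/-! ## §2. `corank_{ℤ_p} Sel_{p^∞}(E/K) ≤ rank_{ℤ_p} X^ε/TX^ε` -/

namespace SignedSelmerDualData

variable {K : Type u} [Field K] [NumberField K] {W : WeierstrassCurve K} [W.IsElliptic] {p : ℕ}
  [Fact p.Prime] {κ : ZpExtension K p} {γ : Field.absoluteGaloisGroup K} {ε : ℤˣ}

/-- **`corank_{ℤ_p} Sel_{p^∞}(E/K) ≤ rank_{ℤ_p} X^ε(E/K_∞)_Γ`** for Kobayashi's signed Selmer group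
(either sign), **unconditionally**: for an elliptic curve `E/K` over a number field, ANY
`ℤ_p`-extension `K_∞/K` with topological generator `γ` and any Pontryagin-dual datum `D` for
`Sel^ε(E/K_∞)` with `X^ε = D.X` finitely generated over `Λ`,
`corank_{ℤ_p} Sel_{p^∞}(E/K) ≤ rank_{ℤ_p} X^ε/TX^ε` (`coinvariantsRank`; the `ℤ_p`-structure on
`X^ε/TX^ε` is the restriction of scalars, as in `coinvariantsRank_eq_finrank_int`). The proof of the
tree's classical `WeierstrassCurve.selmerCorank_le_coinvariantsRank` verbatim on the signed datum:
(1) `θ^ε : Sel_{p^∞}(E/K) → Sel^ε(E/K_∞)` (`resInfty`, landing in `Sel^ε_∞` by §1) has finite kernel —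
it embeds in `ker(H¹(K, E[p^∞]) → H¹(K_∞, E[p^∞]))` (Greenberg's Lemma 3.1,
`finite_subgroupResKer_kerSubgroup`); (2) restriction of characters
`R₀ : X^ε = Hom(Sel^ε_∞, ℚ/ℤ) → Hom(θ^ε(Sel), ℚ/ℤ)` kills `TX^ε` (restricted classes are
`conj_γ`-invariant, `conjH1_resInfty`, `toDual_T_smul`) and descends to `R : X^ε/TX^ε → Hom(θ^ε(Sel), ℚ/ℤ)`
with `ℤ_p`-submodule kernel (`toDual_C_smul`) and `(X^ε/TX^ε)/ker R ≅ Hom(θ^ε(Sel), ℚ/ℤ)` (characters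
of `θ^ε(Sel) ⊆ Sel^ε_∞` extend); (3) the corank count
`ZpCorank.zpCorank_le_finrank_of_addEquiv_characterModule`. No reduction hypothesis at `p`, no
control theorem at `p`, no finiteness of `Ш`.
[cite: GreenbergLNM1716, §1 p. 65 and §3 Lemma 3.1] [cite: Kobayashi2003, Def. 1.1 (p. 2)] -/
theorem selmerCorank_le_coinvariantsRank (hγ : κ.IsTopGenerator γ)
    (D : SignedSelmerDualData W κ γ ε) [Module.Finite (IwasawaAlgebra p) D.X] :
    W.selmerCorank p ≤ coinvariantsRank p D.X := by
  letI : Module ℤ_[p] (coinvariants p D.X) :=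
    Module.compHom _ (algebraMap ℤ_[p] (IwasawaAlgebra p))
  haveI : Module.Finite ℤ_[p] (coinvariants p D.X) := finite_int_coinvariants p D.X
  -- (1) `θ : Sel_{p^∞}(E/K) → Sel^ε(E/K_∞)` and its finite kernel
  let θ : W.selmerGroupPInfty p →+ signedSelmerInfty W κ ε :=
    ((W.resInfty p κ).comp (W.selmerGroupPInfty p).subtype).codRestrict (signedSelmerInfty W κ ε)
      fun c ↦ resInfty_mem_signedSelmerInfty W κ ε c.2
  have hθ : ∀ c : W.selmerGroupPInfty p,
      ((θ c : signedSelmerInfty W κ ε) : W.subgroupH1 p κ.kerSubgroup) = W.resInfty p κ c :=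
    fun _ ↦ rfl
  haveI : Finite θ.ker := by
    haveI := W.finite_subgroupResKer_kerSubgroup κ hγ (p := p)
    refine Finite.of_injective (fun c : θ.ker ↦
      (⟨((c : W.selmerGroupPInfty p) : galH1Primary W p), ?_⟩ :
        subgroupResKer (geomPrimaryTorsion W p) κ.kerSubgroup)) ?_
    · have hc : θ (c : W.selmerGroupPInfty p) = 0 := c.2
      rw [mem_subgroupResKer_iff, ← hθ, hc]
      rfl
    · intro a b hab
      exact Subtype.ext (Subtype.ext (by simpa using congrArg Subtype.val hab))
  haveI : Finite θ.rangeRestrict.ker := by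
    rw [AddMonoidHom.ker_rangeRestrict]; infer_instance
  -- `Sel_{p^∞}(E/K)` and `θ(Sel)` are `p`-primary
  have hA : ∀ c : W.selmerGroupPInfty p, ∃ k : ℕ, p ^ k • c = 0 := fun c ↦ by
    obtain ⟨k, hk⟩ := W.exists_pow_smul_galH1Primary_eq_zero (c : galH1Primary W p)
    exact ⟨k, Subtype.ext (by rw [AddSubgroupClass.coe_nsmul, hk]; rfl)⟩
  have hS : ∀ s : θ.range, ∃ k : ℕ, p ^ k • s = 0 := fun s ↦ by
    obtain ⟨k, hk⟩ := W.exists_pow_smul_subgroupH1_ker_eq_zero κ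
      ((s : signedSelmerInfty W κ ε) : W.subgroupH1 p κ.kerSubgroup)
    refine ⟨k, Subtype.ext (Subtype.ext ?_)⟩
    rw [AddSubgroupClass.coe_nsmul, AddSubgroupClass.coe_nsmul, hk]
    rfl
  -- (2) restriction of characters `R₀ : X → Hom(θ(Sel), ℚ/ℤ)`
  let R₀ : D.X →+ CharacterModule θ.range :=
    { toFun := fun x ↦ (D.toDual x).comp θ.range.subtype
      map_zero' := by rw [map_zero, AddMonoidHom.zero_comp]; rfl
      map_add' := fun x y ↦ by rw [map_add, AddMonoidHom.add_comp]; rfl }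
  have hR₀ : ∀ (x : D.X) (s : θ.range), R₀ x s = D.toDual x (s : signedSelmerInfty W κ ε) :=
    fun _ _ ↦ rfl
  -- `R₀` kills `TX`: restricted classes are `conj_γ`-invariant
  have hR₀T : ∀ x : D.X, R₀ ((PowerSeries.X : IwasawaAlgebra p) • x) = 0 := fun x ↦ by
    refine CharacterModule.ext (A := θ.range) fun s ↦ ?_
    obtain ⟨c, hc⟩ := s.2
    rw [hR₀, D.toDual_T_smul]
    have e : (⟨W.conjH1 p κ.kerSubgroup γ
        ((s : signedSelmerInfty W κ ε) : W.subgroupH1 p κ.kerSubgroup),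
        D.conj_mem _ (s : signedSelmerInfty W κ ε).2⟩ : signedSelmerInfty W κ ε) =
          (s : signedSelmerInfty W κ ε) := by
      apply Subtype.ext
      show W.conjH1 p κ.kerSubgroup γ
        ((s : signedSelmerInfty W κ ε) : W.subgroupH1 p κ.kerSubgroup) = _
      rw [← hc, hθ]
      exact W.conjH1_resInfty κ γ _
    rw [e, sub_self]
    rfl
  -- constants act through `ℤ_p → ℤ/p^k` on `p^k`-torsion classes
  have hR₀C : ∀ (c : ℤ_[p]) (x : D.X) (s : θ.range) (k : ℕ), p ^ k • s = 0 →
      R₀ (PowerSeries.C c • x) s = (PadicInt.toZModPow k c).val • R₀ x s := by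
    intro c x s k hk
    rw [hR₀, hR₀]
    refine D.toDual_C_smul c x _ k ?_
    have h := congrArg (fun t : θ.range ↦ (t : signedSelmerInfty W κ ε)) hk
    simpa using h
  -- descend to `R : X/TX → Hom(θ(Sel), ℚ/ℤ)`
  let R : coinvariants p D.X →+ CharacterModule θ.range :=
    QuotientAddGroup.lift
      (Ideal.span {(PowerSeries.X : IwasawaAlgebra p)} •
        (⊤ : Submodule (IwasawaAlgebra p) D.X)).toAddSubgroup R₀ (by
        intro m hm
        rw [Submodule.mem_toAddSubgroup, Submodule.ideal_span_singleton_smul,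
          Submodule.mem_smul_pointwise_iff_exists] at hm
        obtain ⟨z, -, rfl⟩ := hm
        exact hR₀T z)
  have hRmk : ∀ x : D.X, R (Submodule.Quotient.mk x) = R₀ x := fun _ ↦ rfl
  have hRC : ∀ (c : ℤ_[p]) (m : coinvariants p D.X) (s : θ.range) (k : ℕ), p ^ k • s = 0 →
      R (c • m) s = (PadicInt.toZModPow k c).val • R m s := by
    intro c m s k hk
    induction m using Submodule.Quotient.induction_on with
    | H x =>
      have e : c • (Submodule.Quotient.mk x : coinvariants p D.X) =
          Submodule.Quotient.mk ((PowerSeries.C c : IwasawaAlgebra p) • x) := by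
        change (algebraMap ℤ_[p] (IwasawaAlgebra p) c) •
          (Submodule.Quotient.mk x : coinvariants p D.X) = _
        rw [PowerSeries.algebraMap_eq, Submodule.Quotient.mk_smul]
      rw [e, hRmk, hRmk]
      exact hR₀C c x s k hk
  -- `ker R` is a `ℤ_p`-submodule of `X/TX`
  let Kr : Submodule ℤ_[p] (coinvariants p D.X) :=
    { carrier := {m | R m = 0}
      zero_mem' := map_zero R
      add_mem' := fun {a b} ha hb ↦ by
        simp only [Set.mem_setOf_eq] at ha hb ⊢
        rw [map_add, ha, hb, add_zero]
      smul_mem' := fun c m hm ↦ by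
        simp only [Set.mem_setOf_eq] at hm ⊢
        refine CharacterModule.ext (A := θ.range) fun s ↦ ?_
        obtain ⟨k, hk⟩ := hS s
        rw [hRC c m s k hk, hm]
        exact smul_zero _ }
  have hKr : ∀ m, m ∈ Kr ↔ R m = 0 := fun _ ↦ Iff.rfl
  -- `Ψ : (X/TX)/ker R ≅ Hom(θ(Sel), ℚ/ℤ)`
  let Ψ : (coinvariants p D.X ⧸ Kr) →+ CharacterModule θ.range :=
    QuotientAddGroup.lift Kr.toAddSubgroup R (fun _ hm ↦ hm)
  have hΨ : ∀ m : coinvariants p D.X, Ψ (Submodule.Quotient.mk m) = R m := fun _ ↦ rfl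
  have hΨbij : Function.Bijective Ψ := by
    constructor
    · rw [injective_iff_map_eq_zero]
      intro q hq
      induction q using Submodule.Quotient.induction_on with
      | H m =>
        rw [hΨ] at hq
        exact (Submodule.Quotient.mk_eq_zero _).mpr ((hKr m).mpr hq)
    · intro ψ
      obtain ⟨χ, hχ⟩ := CharacterModule.dual_surjective_of_injective
        (θ.range.subtype.toIntLinearMap) (fun a b h ↦ Subtype.ext h) ψ
      obtain ⟨x, rfl⟩ := D.bijective.2 χ
      refine ⟨Submodule.Quotient.mk (Submodule.Quotient.mk x : coinvariants p D.X), ?_⟩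
      rw [hΨ, hRmk, ← hχ]
      rfl
  -- (3) the corank count
  have h := zpCorank_le_finrank_of_addEquiv_characterModule p hA θ.rangeRestrict
    (AddMonoidHom.rangeRestrict_surjective _) (N := coinvariants p D.X ⧸ Kr)
    (AddEquiv.ofBijective Ψ hΨbij)
  calc W.selmerCorank p = zpCorank (W.selmerGroupPInfty p) p := rfl
    _ ≤ Module.finrank ℤ_[p] (coinvariants p D.X ⧸ Kr) := h
    _ ≤ Module.finrank ℤ_[p] (coinvariants p D.X) := Submodule.finrank_quotient_le _
    _ = coinvariantsRank p D.X := (coinvariantsRank_eq_finrank_int D.X).symm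

/-! ## §3. `T^{corank Sel_{p^∞}(E/K)} ∣ f` for `f ∈ Char(X^ε)` -/

/-- **`corank_{ℤ_p} Sel_{p^∞}(E/K) ≤ ord_{T=0} f` for every `f ∈ Char(X^ε(E/K_∞))`**, `X^ε` finitely
generated `Λ`-torsion: §2 and `rank_{ℤ_p} X/TX ≤ ord_T f`
(`IwasawaAlgebra.coinvariantsRank_le_order_of_mem_charIdeal`, structure theory). The Selmer-corank
twin of `mordellWeilRank_le_order_of_mem_charIdeal`.
[cite: GreenbergLNM1716, §1 p. 65 and §3 Lemma 3.1] [cite: Kobayashi2003, Def. 1.1 and Thm. 1.2 (p. 2)] -/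
theorem selmerCorank_le_order_of_mem_charIdeal (hγ : κ.IsTopGenerator γ)
    (D : SignedSelmerDualData W κ γ ε) [Module.Finite (IwasawaAlgebra p) D.X]
    (hX : Module.IsTorsion (IwasawaAlgebra p) D.X) {f : IwasawaAlgebra p} (hf : f ∈ D.charIdeal) :
    (W.selmerCorank p : ℕ∞) ≤ f.order := by
  have h0 : (W.selmerCorank p : ℕ∞) ≤ (coinvariantsRank p D.X : ℕ∞) := by
    exact_mod_cast D.selmerCorank_le_coinvariantsRank hγ
  exact h0.trans (coinvariantsRank_le_order_of_mem_charIdeal D.X hX f hf)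

/-- **`T^{corank Sel_{p^∞}(E/K)} ∣ f` for every `f ∈ Char(X^ε(E/K_∞))`** (`X^ε` finitely generated
`Λ`-torsion). [cite: GreenbergLNM1716, §1 p. 65 and §3 Lemma 3.1] [cite: Kobayashi2003, Def. 1.1 and Thm. 1.2 (p. 2)] -/
theorem X_pow_selmerCorank_dvd_of_mem_charIdeal (hγ : κ.IsTopGenerator γ)
    (D : SignedSelmerDualData W κ γ ε) [Module.Finite (IwasawaAlgebra p) D.X]
    (hX : Module.IsTorsion (IwasawaAlgebra p) D.X) {f : IwasawaAlgebra p} (hf : f ∈ D.charIdeal) :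
    (PowerSeries.X : IwasawaAlgebra p) ^ W.selmerCorank p ∣ f := by
  have hle := D.selmerCorank_le_order_of_mem_charIdeal hγ hX hf
  exact PowerSeries.X_pow_dvd_iff.mpr fun m hm =>
    PowerSeries.coeff_of_lt_order m (lt_of_lt_of_le (by exact_mod_cast hm) hle)

/-- **`T^{corank Sel_{p^∞}(E/K)} ∣ ξ^ε` for a characteristic power series `ξ^ε`**
(`Char(X^ε) = (ξ^ε)`, `X^ε` finitely generated `Λ`-torsion). In particular `T ∣ ξ^ε` as soon as
`Sel_{p^∞}(E/K)` is infinite (e.g. of odd corank, by a parity theorem) — the input a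
functional-equation argument feeds into a signed main-conjecture squeeze.
[cite: GreenbergLNM1716, §1 p. 65 and §3 Lemma 3.1] [cite: Kobayashi2003, Def. 1.1 and Thm. 1.2 (p. 2)] -/
theorem X_pow_selmerCorank_dvd_of_charIdeal_eq_span (hγ : κ.IsTopGenerator γ)
    (D : SignedSelmerDualData W κ γ ε) [Module.Finite (IwasawaAlgebra p) D.X]
    (hX : Module.IsTorsion (IwasawaAlgebra p) D.X) {ξ : IwasawaAlgebra p}
    (hξ : D.charIdeal = Ideal.span {ξ}) :
    (PowerSeries.X : IwasawaAlgebra p) ^ W.selmerCorank p ∣ ξ :=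
  D.X_pow_selmerCorank_dvd_of_mem_charIdeal hγ hX (hξ ▸ Ideal.mem_span_singleton_self ξ)

end SignedSelmerDualData

end Literature.NumberTheory.EllipticCurves.Kobayashi2003

end
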